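import Mathlib.RingTheory.Derivation.Basic
import Mathlib.RingTheory.Ideal.Quotient.Operations
import Mathlib.LinearAlgebra.Quotient.Basic
import HarnessLib

/-!
# Barrier (Schanuel) `NesterenkoModularScope`: a derivation stabilising an ideal descends to the quotient — proofs only

`Literature/Barriers/Schanuel/NesterenkoModularScopeQuotientDerivation.lean` — proofs-only
groundwork (no definitions, nothing asserted) for LNM 1752 Ch. 10 Proposition 5.1 (named fact
`NesterenkoPhilippon2001_ch10_prop_5_1`): for a `D`-stable prime `𝔮` ("`𝔮` is a prime ideal with
`D𝔮 ⊂ 𝔮`", p. 166) the operator `D` acts on the coordinate ring `ℂ[x₁, x₂, x₃]/𝔮 = ℂ[ξ₁, ξ₂, ξ₃]`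
of the curve. In general:

* `exists_derivation_quotient` — a `K`-derivation `D` of a `K`-algebra `R` with `D(I) ⊆ I`
  induces a `K`-derivation `D̄` of `R/I` with `D̄(ā) = (Da)‾`.

## References

* [NesterenkoPhilippon2001] LNM 1752, Ch. 10 §5, proof of Prop. 5.1 (p. 166).
-/

noncomputable section

namespace Literature.Barriers.Schanuel

/-- **A derivation stabilising an ideal descends to the quotient.**
[cite: NesterenkoPhilippon2001, Ch. 10 §5, proof of Prop. 5.1 (p. 166)] -/
theorem exists_derivation_quotient {K R : Type*} [CommRing K] [CommRing R] [Algebra K R]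
    (D : Derivation K R R) (I : Ideal R) (hI : ∀ a ∈ I, D a ∈ I) :
    ∃ D' : Derivation K (R ⧸ I) (R ⧸ I),
      ∀ a : R, D' (Ideal.Quotient.mk I a) = Ideal.Quotient.mk I (D a) := by
  -- the `K`-linear map `R → R/I`, `a ↦ (Da)‾`, kills `I`
  let L : R →ₗ[K] R ⧸ I := (Ideal.Quotient.mkₐ K I).toLinearMap ∘ₗ D.toLinearMap
  have hL : ∀ a : R, L a = Ideal.Quotient.mk I (D a) := fun a => rfl
  have hker : I.restrictScalars K ≤ LinearMap.ker L := by
    intro a ha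
    rw [LinearMap.mem_ker, hL, Ideal.Quotient.eq_zero_iff_mem]
    exact hI a ha
  -- factor through the quotient (as a `K`-module) and transport to `R ⧸ I`
  let L₁ : (R ⧸ I.restrictScalars K) →ₗ[K] R ⧸ I := (I.restrictScalars K).liftQ L hker
  let e : (R ⧸ I.restrictScalars K) ≃ₗ[K] R ⧸ I := Submodule.Quotient.restrictScalarsEquiv K I
  let L₂ : (R ⧸ I) →ₗ[K] R ⧸ I := L₁ ∘ₗ e.symm.toLinearMap
  have hL₂ : ∀ a : R, L₂ (Ideal.Quotient.mk I a) = Ideal.Quotient.mk I (D a) := by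
    intro a
    have he : e.symm (Ideal.Quotient.mk I a) = Submodule.Quotient.mk a := by
      rw [LinearEquiv.symm_apply_eq]
      rfl
    show L₁ (e.symm (Ideal.Quotient.mk I a)) = _
    rw [he]
    exact hL a
  refine ⟨{ toLinearMap := L₂
            map_one_eq_zero' := ?_
            leibniz' := ?_ }, hL₂⟩
  · rw [← map_one (Ideal.Quotient.mk I), hL₂, Derivation.map_one_eq_zero, map_zero]
  · intro a b
    obtain ⟨a, rfl⟩ := Ideal.Quotient.mk_surjective a
    obtain ⟨b, rfl⟩ := Ideal.Quotient.mk_surjective b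
    rw [← map_mul, hL₂, hL₂, hL₂, Derivation.leibniz, map_add, smul_eq_mul, smul_eq_mul,
      smul_eq_mul, smul_eq_mul, map_mul, map_mul]

end Literature.Barriers.Schanuel

end
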